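import Mathlib.Analysis.Complex.Basic
import Mathlib.Analysis.Calculus.FDeriv.Comp
import Mathlib.Analysis.Calculus.Deriv.Basic
import Mathlib.Analysis.SpecialFunctions.Complex.Analytic
import HarnessLib

/-!
# The Cauchy–Riemann expression `vₓ + J(v) v_y` of a map from the plane, and its transformation
# under holomorphic reparametrisation of the domain and intertwining maps of the target

For a field `J : F → (F →L[ℝ] F)` of endomorphisms of a real normed space `F` (an almost complex
structure read in coordinates) and a map `v : ℂ → F`, the **Cauchy–Riemann expression** at `z` is

  `crExpr J v z = Dv(z) 1 + J (v z) (Dv(z) I)`,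

so that `v` is `J`-holomorphic at `z` (`Dv(z)(I ζ) = J (v z) (Dv(z) ζ)` for all `ζ`) iff
`crExpr J v z = 0` (`crExpr_eq_zero_iff`, given `J (v z) ∘ J (v z) = -1`). This file records the
two transformation rules used to glue the chart expressions of the nonlinear Cauchy–Riemann
operator of a map from the Riemann sphere (McDuff–Salamon 2012, §2.2; Wendl 2018, §2.1):

* `crExpr_comp_holomorphic` — DOMAIN: for `h` with complex derivative `a` at `w`,
  `crExpr J (v ∘ h) w = a.re • crExpr J v (h w) - a.im • J (v (h w)) (crExpr J v (h w))`
  (the expression is a `(0,1)`-form: it transforms by `conj a` acting through `J`);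
* `crExpr_comp_left` — TARGET: for `Ψ` differentiable at `v z` intertwining `J` and `J'`
  (`J' (Ψ (v z)) ∘ DΨ = DΨ ∘ J (v z)`), `crExpr J' (Ψ ∘ v) z = DΨ (crExpr J v z)`;

and the **complex-linear part** `clPart J M = ½ (M - I • M ∘ J)` of a real-linear map `M` from
`(F, J)` to a complex normed space, with `clPart J M (J x) = I • clPart J M x`, so that the factor
`a.re - a.im • J` above becomes multiplication by `conj a` after composing with `clPart J M`
(`clPart_apply_re_sub_im`), and `clPart J' M ∘ T = clPart J (M ∘ T)` for `T` intertwining `J` and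
`J'` (`clPart_comp_of_intertwine`). Everything is elementary linear algebra and the chain rule.

## References

* D. McDuff, D. Salamon, *J-holomorphic Curves and Symplectic Topology*, 2nd ed. (2012), §2.2.
  [McDuffSalamon2012]
* C. Wendl, *Holomorphic Curves in Low Dimensions*, LNM 2216 (2018), §2.1. [Wendl2018]
-/

noncomputable section

open Complex

namespace Literature.Geometry.Symplectic

namespace CRExpression

variable {F : Type*} [NormedAddCommGroup F] [NormedSpace ℝ F]

/-- **The Cauchy–Riemann expression** `vₓ + J(v) v_y` of `v : ℂ → F` at `z` for the operator
field `J`: `Dv(z) 1 + J (v z) (Dv(z) I)`. [cite: McDuffSalamon2012, §2.2] -/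
def crExpr (J : F → F →L[ℝ] F) (v : ℂ → F) (z : ℂ) : F :=
  fderiv ℝ v z 1 + J (v z) (fderiv ℝ v z I)

/-- Unfolding `crExpr`. [folklore] -/
theorem crExpr_def (J : F → F →L[ℝ] F) (v : ℂ → F) (z : ℂ) :
    crExpr J v z = fderiv ℝ v z 1 + J (v z) (fderiv ℝ v z I) := rfl

/-- A real-linear map out of `ℂ` is determined by its values at `1` and `I`:
`L ζ = ζ.re • L 1 + ζ.im • L I`. [folklore] -/
theorem realLinear_apply_eq (L : ℂ →L[ℝ] F) (ζ : ℂ) : L ζ = ζ.re • L 1 + ζ.im • L I := by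
  conv_lhs => rw [← re_add_im ζ]
  rw [map_add]
  have h1 : L (ζ.re : ℂ) = ζ.re • L 1 := by
    rw [show ((ζ.re : ℂ)) = (ζ.re : ℝ) • (1 : ℂ) by simp, L.map_smul]
  have h2 : L (ζ.im * I) = ζ.im • L I := by
    rw [show ((ζ.im : ℂ) * I) = (ζ.im : ℝ) • I by simp, L.map_smul]
  rw [h1, h2]

/-- **`J`-holomorphicity at a point is the vanishing of the Cauchy–Riemann expression**, provided
`J (v z)` squares to `-1`. [cite: McDuffSalamon2012, §2.2] -/
theorem crExpr_eq_zero_iff {J : F → F →L[ℝ] F} {v : ℂ → F} {z : ℂ}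
    (hJ : ∀ x : F, J (v z) (J (v z) x) = -x) :
    crExpr J v z = 0 ↔ ∀ ζ : ℂ, fderiv ℝ v z (I * ζ) = J (v z) (fderiv ℝ v z ζ) := by
  constructor
  · intro h ζ
    have h1 : fderiv ℝ v z 1 = -J (v z) (fderiv ℝ v z I) := eq_neg_of_add_eq_zero_left h
    have hI : fderiv ℝ v z I = J (v z) (fderiv ℝ v z 1) := by
      rw [h1, map_neg, hJ, neg_neg]
    rw [realLinear_apply_eq (fderiv ℝ v z) (I * ζ), realLinear_apply_eq (fderiv ℝ v z) ζ]
    simp only [mul_re, I_re, zero_mul, I_im, one_mul, zero_sub, mul_im, neg_smul,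
      map_add, map_smul, hI, hJ, smul_neg]
    abel
  · intro h
    have h1 := h 1
    rw [mul_one] at h1
    -- `Dv 1 + J (Dv I) = Dv 1 + J (J (Dv 1)) = Dv 1 - Dv 1 = 0`
    rw [crExpr_def, h1, hJ, add_neg_cancel]

/-! ### Transformation under holomorphic reparametrisation of the domain -/

/-- Real Fréchet derivative of a function with complex derivative `a`: multiplication by `a`.
[folklore] -/
theorem fderiv_real_of_hasDerivAt {h : ℂ → ℂ} {a w : ℂ} (hh : HasDerivAt h a w) (ζ : ℂ) :
    fderiv ℝ h w ζ = a * ζ := by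
  rw [(hh.hasFDerivAt.restrictScalars ℝ).fderiv]
  simp [mul_comm]

/-- **DOMAIN transformation rule.** If `h` has complex derivative `a` at `w` and `v` is real
differentiable at `h w` with `J (v (h w))² = -1`, then
`crExpr J (v ∘ h) w = a.re • crExpr J v (h w) - a.im • J (v (h w)) (crExpr J v (h w))`: the
Cauchy–Riemann expression transforms like a `(0,1)`-form, by `conj a` acting through `J`.
[cite: McDuffSalamon2012, §2.2] -/
theorem crExpr_comp_holomorphic {J : F → F →L[ℝ] F} {v : ℂ → F} {h : ℂ → ℂ} {a w : ℂ}
    (hh : HasDerivAt h a w) (hv : DifferentiableAt ℝ v (h w))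
    (hJ : ∀ x : F, J (v (h w)) (J (v (h w)) x) = -x) :
    crExpr J (v ∘ h) w =
      a.re • crExpr J v (h w) - a.im • J (v (h w)) (crExpr J v (h w)) := by
  have hcomp : fderiv ℝ (v ∘ h) w = (fderiv ℝ v (h w)).comp (fderiv ℝ h w) :=
    fderiv_comp w hv (hh.differentiableAt.restrictScalars ℝ)
  have hD : ∀ ζ : ℂ, fderiv ℝ (v ∘ h) w ζ = fderiv ℝ v (h w) (a * ζ) := fun ζ => by
    rw [hcomp, ContinuousLinearMap.comp_apply, fderiv_real_of_hasDerivAt hh]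
  rw [crExpr_def, crExpr_def, Function.comp_apply, hD, hD, mul_one,
    realLinear_apply_eq (fderiv ℝ v (h w)) a, realLinear_apply_eq (fderiv ℝ v (h w)) (a * I)]
  simp only [mul_re, I_re, mul_zero, I_im, mul_one, zero_sub, mul_im, add_zero, map_add,
    map_smul, map_neg, neg_smul, hJ, smul_add, smul_neg]
  abel

/-! ### Transformation under an intertwining map of the target -/

/-- **TARGET transformation rule.** If `Ψ : F → G` is real differentiable at `v z`, `v` at `z`,
and `DΨ` intertwines the operator fields (`J' (Ψ (v z)) ∘ DΨ(v z) = DΨ(v z) ∘ J (v z)`), then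
`crExpr J' (Ψ ∘ v) z = DΨ(v z) (crExpr J v z)`. [cite: McDuffSalamon2012, §2.2] -/
theorem crExpr_comp_left {G : Type*} [NormedAddCommGroup G] [NormedSpace ℝ G]
    {J : F → F →L[ℝ] F} {J' : G → G →L[ℝ] G} {v : ℂ → F} {Ψ : F → G} {z : ℂ}
    (hΨ : DifferentiableAt ℝ Ψ (v z)) (hv : DifferentiableAt ℝ v z)
    (hint : ∀ x : F, J' (Ψ (v z)) (fderiv ℝ Ψ (v z) x) = fderiv ℝ Ψ (v z) (J (v z) x)) :
    crExpr J' (Ψ ∘ v) z = fderiv ℝ Ψ (v z) (crExpr J v z) := by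
  have hcomp : fderiv ℝ (Ψ ∘ v) z = (fderiv ℝ Ψ (v z)).comp (fderiv ℝ v z) :=
    fderiv_comp z hΨ hv
  rw [crExpr_def, crExpr_def, hcomp, Function.comp_apply, ContinuousLinearMap.comp_apply,
    ContinuousLinearMap.comp_apply, hint, map_add]

/-! ### The complex-linear part of a real-linear map out of `(F, J)` -/

section CLPart

variable {G : Type*} [NormedAddCommGroup G] [NormedSpace ℂ G]

/-- **The complex-linear part** of a real-linear map `M : F →L[ℝ] G` from `(F, J)` to a complex
normed space: `clPart J M = ½ (M - I • (M ∘ J))`. [folklore] -/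
def clPart (J : F →L[ℝ] F) (M : F →L[ℝ] G) : F →L[ℝ] G :=
  (2⁻¹ : ℝ) • (M - I • (M.comp J))

/-- Pointwise formula for the complex-linear part. [folklore] -/
theorem clPart_apply (J : F →L[ℝ] F) (M : F →L[ℝ] G) (x : F) :
    clPart J M x = (2⁻¹ : ℝ) • (M x - I • M (J x)) := rfl

/-- The complex-linear part intertwines `J` with multiplication by `I` (when `J² = -1`).
[folklore] -/
theorem clPart_apply_J {J : F →L[ℝ] F} (hJ : ∀ x, J (J x) = -x) (M : F →L[ℝ] G) (x : F) :
    clPart J M (J x) = I • clPart J M x := by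
  rw [clPart_apply, clPart_apply, hJ, map_neg, smul_neg, sub_neg_eq_add, smul_comm I (2⁻¹ : ℝ),
    smul_sub, ← mul_smul, I_mul_I, neg_one_smul, sub_neg_eq_add, add_comm]

/-- The factor `a.re - a.im • J` of the domain rule becomes multiplication by `conj a` after the
complex-linear part: `clPart J M (a.re • x - a.im • J x) = conj a • clPart J M x`. [folklore] -/
theorem clPart_apply_re_sub_im {J : F →L[ℝ] F} (hJ : ∀ x, J (J x) = -x) (M : F →L[ℝ] G)
    (a : ℂ) (x : F) :
    clPart J M (a.re • x - a.im • J x) = (starRingEnd ℂ) a • clPart J M x := by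
  rw [map_sub, map_smul, map_smul, clPart_apply_J hJ, ← Complex.coe_smul, ← Complex.coe_smul,
    smul_smul, ← sub_smul]
  congr 1
  apply Complex.ext <;> simp

/-- If `M` is already `(J, I)`-linear then its complex-linear part is `M`. [folklore] -/
theorem clPart_eq_self {J : F →L[ℝ] F} (M : F →L[ℝ] G) (hM : ∀ x, M (J x) = I • M x) :
    clPart J M = M := by
  ext x
  rw [clPart_apply, hM, ← mul_smul, I_mul_I, neg_one_smul, sub_neg_eq_add, ← two_smul ℝ (M x),
    smul_smul]
  norm_num

/-- A complex-linear map on the target factors out of the complex-linear part: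
`clPart J (L ∘ M) = L ∘ clPart J M` for `L : G →L[ℂ] G'`. [folklore] -/
theorem clPart_comp_complexLinear {G' : Type*} [NormedAddCommGroup G'] [NormedSpace ℂ G']
    (J : F →L[ℝ] F) (M : F →L[ℝ] G) (L : G →L[ℂ] G') :
    clPart J ((L.restrictScalars ℝ).comp M) = (L.restrictScalars ℝ).comp (clPart J M) := by
  ext x
  simp [clPart_apply, map_sub, smul_sub]

/-- **Intertwining maps pass through the complex-linear part**: if `T : F →L[ℝ] F'` satisfies
`J' ∘ T = T ∘ J` then `clPart J' M ∘ T = clPart J (M ∘ T)`. [folklore] -/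
theorem clPart_comp_of_intertwine {F' : Type*} [NormedAddCommGroup F'] [NormedSpace ℝ F']
    {J : F →L[ℝ] F} {J' : F' →L[ℝ] F'} (T : F →L[ℝ] F') (hT : ∀ x, J' (T x) = T (J x))
    (M : F' →L[ℝ] G) : (clPart J' M).comp T = clPart J (M.comp T) := by
  ext x
  simp [clPart_apply, hT]

end CLPart

end CRExpression

end Literature.Geometry.Symplectic

end
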